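import Mathlib
import HarnessLib
import Summits.Ventures.LatticeQCDFlow.Exactness.IMHColdStartSampleVariance
import Summits.Ventures.LatticeQCDFlow.Scaling.AutoregressiveGaugeHeatBathColdExact

/-!
# LatticeQCDFlow / Scaling — the cold-started exact one-plaquette heat-bath sampler: at equilibrium the sample variance underestimates `Var_π f` by at least `Var_π f/N` — the naive error bar is optimistic, `A = Z/(c^{#B} M^k)`

HONEST FRAMING: exact (Metropolis-corrected) sampling algorithms for lattice gauge theory;
figures of merit are autocorrelation/cost numbers at stated couplings and volumes; no
continuum-physics claim.

Venture `LatticeQCDFlow` (cell pub-lqcd), topic `Scaling`, FANOUT row 30 (lean-1, GEN-33) — OUR WORK, the gauge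
instance of this generation's abstract `Exactness/` files.  Setting: `L ≥ 2`; `w` continuous, `0 < m ≤ w ≤ M = w(1)`; `(B, t, rank)` a ranked
structure, `k = #Bᶜ`; target `π = (F/Z)·Haar^{⊗E}`, proposal `q = (F_B/Z_B)·Haar^{⊗E}`, exact sampler
`K = indepMH q (Z_B F_R/Z)`, cold configuration `U ≡ 1` = the mode of the importance weight, `A = Z/(c^{#B} M^k)` its
acceptance mass (GEN-28 `heatBath_cold_acceptMass_eq`); `r = 1 − A`; path space = Mathlib `Kernel.trajMeasure`
(`P_cold` from the cold configuration, `P_π` the equilibrium run).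

The abstract file `Exactness/IMHColdStartSampleVariance` (this generation) computed the expectation of the SAMPLE VARIANCE
`v̂_N = (1/N)Σ_{i<N}(f(U_i) − m_N)²` (`m_N` the run's mean) of an exact sampler's run, at equilibrium and from the mode.  For the
exact one-plaquette heat-bath sampler (`f` bounded measurable, `δf = f(cold) − π f`, `MSE_μ(N) = E_μ[(m_N − π f)²]`):

* **`heatBath_sampleVariance_stationary_two_sided`** — at equilibrium `Var_π f·(1 − (2/A − 1)/N) ≤ E_π[v̂_N] ≤ Var_π f·(1 − 1/N)`: the sample
  variance of the run underestimates `Var_π f` by exactly the mean-square error of the mean (abstract `chain_sampleVariance_stationary_eq`),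
  which for an exact sampler is at least `Var_π f/N` — THE BESSEL CORRECTION `N/(N − 1)` IS NEVER ENOUGH;
* **`heatBath_naiveErrorBar_stationary_le`** — THE NAIVE (i.i.d.) ERROR BAR IS OPTIMISTIC IN EXPECTATION at every `N ≥ 2`:
  `E_π[v̂_N]/(N − 1) ≤ Var_π f/N ≤ MSE_π(N)`;

NOT CLAIMED: the variance of `v̂_N`; empirically centred autocovariances at positive lag; any number for a specific weight.

The `Fact` instance is the measurability of the kernel weight (discharged by the measurability clause of GEN-28's
acceptance-mass theorem).  No `def`, no `sorry`, nothing cited as a fact beyond the tree.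
-/

noncomputable section

namespace Summit.Ventures.LatticeQCDFlow.Theory2.Autoregressive

open MeasureTheory ProbabilityTheory Function Finset
open scoped ENNReal
open Literature.MathematicalPhysics.QuantumFieldTheory Literature.MathematicalPhysics.QuantumLattice
open Summit.Ventures.LatticeQCDFlow.Exactness Summit.Ventures.LatticeQCDFlow.Scoring

variable {d L : ℕ} [NeZero L] {G : Type*} [Group G] [TopologicalSpace G] [IsTopologicalGroup G]
  [CompactSpace G] [SecondCountableTopology G] [MeasurableSpace G] [BorelSpace G]
/-- **`Var_π f·(1 − (2/A − 1)/N) ≤ E_π[v̂_N] ≤ Var_π f·(1 − 1/N)`** for the equilibrium run of the exact one-plaquette heat-bath sampler: the Bessel correction never suffices. [ours] -/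
theorem heatBath_sampleVariance_stationary_two_sided [MeasurableSingletonClass G] (hL : 2 ≤ L) {w : G → ℝ} (hw : Continuous w) {m M : ℝ} (hm0 : 0 < m)
    (hm : ∀ g, m ≤ w g) (hM : ∀ g, w g ≤ M) (hw1 : w 1 = M)
    (B : Finset (Plaquette d L)) (t : Plaquette d L → Edge d L)
    (ht : ∀ p ∈ B, t p ∈ ({(p.1, p.2.1.1), (p.1.shift p.2.1.1, p.2.1.2),
        (p.1.shift p.2.1.2, p.2.1.1), (p.1, p.2.1.2)} : Finset (Edge d L)))
    (rank : Plaquette d L → ℕ)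
    (hrank : ∀ p ∈ B, ∀ p' ∈ B, p ≠ p' → t p ∈ ({(p'.1, p'.2.1.1), (p'.1.shift p'.2.1.1, p'.2.1.2),
        (p'.1.shift p'.2.1.2, p'.2.1.1), (p'.1, p'.2.1.2)} : Finset (Edge d L)) → rank p < rank p')
    (π q : Measure (GaugeConfig d L G)) [IsProbabilityMeasure π] [IsProbabilityMeasure q]
    (hπ : π = (Measure.pi fun _ : Edge d L => haarProbability G).withDensity fun U =>
      ENNReal.ofReal ((∏ p : Plaquette d L, w (plaquetteHolonomy U p.1 p.2.1.1 p.2.1.2)) /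
        ∫ V, ∏ p : Plaquette d L, w (plaquetteHolonomy V p.1 p.2.1.1 p.2.1.2)
          ∂(Measure.pi fun _ : Edge d L => haarProbability G)))
    (hq : q = (Measure.pi fun _ : Edge d L => haarProbability G).withDensity fun U =>
      ENNReal.ofReal ((∏ p ∈ B, w (plaquetteHolonomy U p.1 p.2.1.1 p.2.1.2)) /
        ∫ V, ∏ p ∈ B, w (plaquetteHolonomy V p.1 p.2.1.1 p.2.1.2)
          ∂(Measure.pi fun _ : Edge d L => haarProbability G)))
    [Fact (Measurable (fun U =>
        ((∫ V, ∏ p : Plaquette d L, w (plaquetteHolonomy V p.1 p.2.1.1 p.2.1.2)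
            ∂(Measure.pi fun _ : Edge d L => haarProbability G)) /
          ((∫ V, ∏ p ∈ B, w (plaquetteHolonomy V p.1 p.2.1.1 p.2.1.2)
            ∂(Measure.pi fun _ : Edge d L => haarProbability G)) *
            ∏ p ∈ Finset.univ \ B, w (plaquetteHolonomy U p.1 p.2.1.1 p.2.1.2)))⁻¹))]
    {f : GaugeConfig d L G → ℝ} (hf : Measurable f) {Cf : ℝ} (hCf : ∀ U, |f U| ≤ Cf) {N : ℕ} (hN : N ≠ 0) :
    (∫ U, (f U - ∫ V', f V' ∂π) ^ 2 ∂π) * (1 - (2 * ((∫ V, ∏ p : Plaquette d L, w (plaquetteHolonomy V p.1 p.2.1.1 p.2.1.2)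
            ∂(Measure.pi fun _ : Edge d L => haarProbability G)) /
        ((∫ g, w g ∂(haarProbability G)) ^ B.card * M ^ (Finset.univ \ B).card))⁻¹ - 1) / N) ≤
      ∫ x, (∑ i ∈ Finset.range N, (f (x i) - (∑ j ∈ Finset.range N, f (x j)) / N) ^ 2) / N ∂(Kernel.trajMeasure (X := fun _ : ℕ => GaugeConfig d L G) π
        (fun n : ℕ => (indepMH q (fun U =>
        ((∫ V, ∏ p : Plaquette d L, w (plaquetteHolonomy V p.1 p.2.1.1 p.2.1.2)
            ∂(Measure.pi fun _ : Edge d L => haarProbability G)) /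
          ((∫ V, ∏ p ∈ B, w (plaquetteHolonomy V p.1 p.2.1.1 p.2.1.2)
            ∂(Measure.pi fun _ : Edge d L => haarProbability G)) *
            ∏ p ∈ Finset.univ \ B, w (plaquetteHolonomy U p.1 p.2.1.1 p.2.1.2)))⁻¹)).comap
          (fun h : (i : ↥(Finset.Iic n)) → GaugeConfig d L G => h ⟨n, Finset.mem_Iic.2 le_rfl⟩)
          (measurable_pi_apply _))) ∧
    ∫ x, (∑ i ∈ Finset.range N, (f (x i) - (∑ j ∈ Finset.range N, f (x j)) / N) ^ 2) / N ∂(Kernel.trajMeasure (X := fun _ : ℕ => GaugeConfig d L G) π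
        (fun n : ℕ => (indepMH q (fun U =>
        ((∫ V, ∏ p : Plaquette d L, w (plaquetteHolonomy V p.1 p.2.1.1 p.2.1.2)
            ∂(Measure.pi fun _ : Edge d L => haarProbability G)) /
          ((∫ V, ∏ p ∈ B, w (plaquetteHolonomy V p.1 p.2.1.1 p.2.1.2)
            ∂(Measure.pi fun _ : Edge d L => haarProbability G)) *
            ∏ p ∈ Finset.univ \ B, w (plaquetteHolonomy U p.1 p.2.1.1 p.2.1.2)))⁻¹)).comap
          (fun h : (i : ↥(Finset.Iic n)) → GaugeConfig d L G => h ⟨n, Finset.mem_Iic.2 le_rfl⟩)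
          (measurable_pi_apply _))) ≤
      (∫ U, (f U - ∫ V', f V' ∂π) ^ 2 ∂π) * (1 - 1 / N) := by
  obtain ⟨hA, hρq, hmax, hρm, hρpos⟩ := heatBath_cold_acceptMass_eq hL hw hm0 hm hM hw1 B t ht rank hrank π q hπ hq
  set cold : GaugeConfig d L G := fun _ => (1 : G) with hcold
  set ρ : GaugeConfig d L G → ℝ := fun U => (∫ V, ∏ p : Plaquette d L, w (plaquetteHolonomy V p.1 p.2.1.1 p.2.1.2)
            ∂(Measure.pi fun _ : Edge d L => haarProbability G)) /
          ((∫ V, ∏ p ∈ B, w (plaquetteHolonomy V p.1 p.2.1.1 p.2.1.2)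
            ∂(Measure.pi fun _ : Edge d L => haarProbability G)) *
            ∏ p ∈ Finset.univ \ B, w (plaquetteHolonomy U p.1 p.2.1.1 p.2.1.2)) with hρ
  have hw0' : ∀ U, 0 < (ρ U)⁻¹ := fun U => inv_pos.2 (hρpos U)
  have hπ' : (q.withDensity fun U => ENNReal.ofReal (ρ U)⁻¹) = π := withDensity_inv_density hρm hρpos hρq
  haveI : IsProbabilityMeasure (q.withDensity fun U => ENNReal.ofReal (ρ U)⁻¹) := by rw [hπ']; infer_instance
  have hone : ∫⁻ y, ENNReal.ofReal (ρ y)⁻¹ ∂q = ENNReal.ofReal 1 := by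
    have h : π Set.univ = 1 := measure_univ
    rw [← hπ', withDensity_apply _ MeasurableSet.univ, Measure.restrict_univ] at h
    rw [h, ENNReal.ofReal_one]
  have hA' := imhAcceptMass_toReal_eq_of_forall_le (q := q) hw0' cold hmax zero_le_one hone
  have hrate : ((ρ cold)⁻¹)⁻¹ = (∫ V, ∏ p : Plaquette d L, w (plaquetteHolonomy V p.1 p.2.1.1 p.2.1.2)
            ∂(Measure.pi fun _ : Edge d L => haarProbability G)) /
        ((∫ g, w g ∂(haarProbability G)) ^ B.card * M ^ (Finset.univ \ B).card) := by
    rw [← hA, hA', one_div]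
  have hrate' : (ρ cold)⁻¹ = (((∫ V, ∏ p : Plaquette d L, w (plaquetteHolonomy V p.1 p.2.1.1 p.2.1.2)
            ∂(Measure.pi fun _ : Edge d L => haarProbability G)) /
        ((∫ g, w g ∂(haarProbability G)) ^ B.card * M ^ (Finset.univ \ B).card)))⁻¹ := by
    rw [← hrate, inv_inv]
  have h := imh_chain_sampleVariance_stationary_two_sided (q := q) hw0' hmax hf hCf hN (x₀ := cold)
  rw [hπ', hrate'] at h
  exact h

/-- **THE NAIVE ERROR BAR IS OPTIMISTIC**: `E_π[v̂_N]/(N − 1) ≤ Var_π f/N ≤ MSE_π(N)` for the equilibrium run of the exact one-plaquette heat-bath sampler, every `N ≥ 2`. [ours] -/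
theorem heatBath_naiveErrorBar_stationary_le [MeasurableSingletonClass G] (hL : 2 ≤ L) {w : G → ℝ} (hw : Continuous w) {m M : ℝ} (hm0 : 0 < m)
    (hm : ∀ g, m ≤ w g) (hM : ∀ g, w g ≤ M) (hw1 : w 1 = M)
    (B : Finset (Plaquette d L)) (t : Plaquette d L → Edge d L)
    (ht : ∀ p ∈ B, t p ∈ ({(p.1, p.2.1.1), (p.1.shift p.2.1.1, p.2.1.2),
        (p.1.shift p.2.1.2, p.2.1.1), (p.1, p.2.1.2)} : Finset (Edge d L)))
    (rank : Plaquette d L → ℕ)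
    (hrank : ∀ p ∈ B, ∀ p' ∈ B, p ≠ p' → t p ∈ ({(p'.1, p'.2.1.1), (p'.1.shift p'.2.1.1, p'.2.1.2),
        (p'.1.shift p'.2.1.2, p'.2.1.1), (p'.1, p'.2.1.2)} : Finset (Edge d L)) → rank p < rank p')
    (π q : Measure (GaugeConfig d L G)) [IsProbabilityMeasure π] [IsProbabilityMeasure q]
    (hπ : π = (Measure.pi fun _ : Edge d L => haarProbability G).withDensity fun U =>
      ENNReal.ofReal ((∏ p : Plaquette d L, w (plaquetteHolonomy U p.1 p.2.1.1 p.2.1.2)) /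
        ∫ V, ∏ p : Plaquette d L, w (plaquetteHolonomy V p.1 p.2.1.1 p.2.1.2)
          ∂(Measure.pi fun _ : Edge d L => haarProbability G)))
    (hq : q = (Measure.pi fun _ : Edge d L => haarProbability G).withDensity fun U =>
      ENNReal.ofReal ((∏ p ∈ B, w (plaquetteHolonomy U p.1 p.2.1.1 p.2.1.2)) /
        ∫ V, ∏ p ∈ B, w (plaquetteHolonomy V p.1 p.2.1.1 p.2.1.2)
          ∂(Measure.pi fun _ : Edge d L => haarProbability G)))
    [Fact (Measurable (fun U =>
        ((∫ V, ∏ p : Plaquette d L, w (plaquetteHolonomy V p.1 p.2.1.1 p.2.1.2)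
            ∂(Measure.pi fun _ : Edge d L => haarProbability G)) /
          ((∫ V, ∏ p ∈ B, w (plaquetteHolonomy V p.1 p.2.1.1 p.2.1.2)
            ∂(Measure.pi fun _ : Edge d L => haarProbability G)) *
            ∏ p ∈ Finset.univ \ B, w (plaquetteHolonomy U p.1 p.2.1.1 p.2.1.2)))⁻¹))]
    {f : GaugeConfig d L G → ℝ} (hf : Measurable f) {Cf : ℝ} (hCf : ∀ U, |f U| ≤ Cf) {N : ℕ} (hN : 2 ≤ N) :
    (∫ x, (∑ i ∈ Finset.range N, (f (x i) - (∑ j ∈ Finset.range N, f (x j)) / N) ^ 2) / N ∂(Kernel.trajMeasure (X := fun _ : ℕ => GaugeConfig d L G) π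
        (fun n : ℕ => (indepMH q (fun U =>
        ((∫ V, ∏ p : Plaquette d L, w (plaquetteHolonomy V p.1 p.2.1.1 p.2.1.2)
            ∂(Measure.pi fun _ : Edge d L => haarProbability G)) /
          ((∫ V, ∏ p ∈ B, w (plaquetteHolonomy V p.1 p.2.1.1 p.2.1.2)
            ∂(Measure.pi fun _ : Edge d L => haarProbability G)) *
            ∏ p ∈ Finset.univ \ B, w (plaquetteHolonomy U p.1 p.2.1.1 p.2.1.2)))⁻¹)).comap
          (fun h : (i : ↥(Finset.Iic n)) → GaugeConfig d L G => h ⟨n, Finset.mem_Iic.2 le_rfl⟩)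
          (measurable_pi_apply _)))) / (N - 1) ≤
      (∫ U, (f U - ∫ V', f V' ∂π) ^ 2 ∂π) / N ∧
    (∫ U, (f U - ∫ V', f V' ∂π) ^ 2 ∂π) / N ≤
      ∫ x, ((∑ i ∈ Finset.range N, f (x i)) / N - ∫ V', f V' ∂π) ^ 2 ∂(Kernel.trajMeasure (X := fun _ : ℕ => GaugeConfig d L G) π
        (fun n : ℕ => (indepMH q (fun U =>
        ((∫ V, ∏ p : Plaquette d L, w (plaquetteHolonomy V p.1 p.2.1.1 p.2.1.2)
            ∂(Measure.pi fun _ : Edge d L => haarProbability G)) /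
          ((∫ V, ∏ p ∈ B, w (plaquetteHolonomy V p.1 p.2.1.1 p.2.1.2)
            ∂(Measure.pi fun _ : Edge d L => haarProbability G)) *
            ∏ p ∈ Finset.univ \ B, w (plaquetteHolonomy U p.1 p.2.1.1 p.2.1.2)))⁻¹)).comap
          (fun h : (i : ↥(Finset.Iic n)) → GaugeConfig d L G => h ⟨n, Finset.mem_Iic.2 le_rfl⟩)
          (measurable_pi_apply _))) := by
  obtain ⟨hA, hρq, hmax, hρm, hρpos⟩ := heatBath_cold_acceptMass_eq hL hw hm0 hm hM hw1 B t ht rank hrank π q hπ hq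
  set cold : GaugeConfig d L G := fun _ => (1 : G) with hcold
  set ρ : GaugeConfig d L G → ℝ := fun U => (∫ V, ∏ p : Plaquette d L, w (plaquetteHolonomy V p.1 p.2.1.1 p.2.1.2)
            ∂(Measure.pi fun _ : Edge d L => haarProbability G)) /
          ((∫ V, ∏ p ∈ B, w (plaquetteHolonomy V p.1 p.2.1.1 p.2.1.2)
            ∂(Measure.pi fun _ : Edge d L => haarProbability G)) *
            ∏ p ∈ Finset.univ \ B, w (plaquetteHolonomy U p.1 p.2.1.1 p.2.1.2)) with hρ
  have hw0' : ∀ U, 0 < (ρ U)⁻¹ := fun U => inv_pos.2 (hρpos U)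
  have hπ' : (q.withDensity fun U => ENNReal.ofReal (ρ U)⁻¹) = π := withDensity_inv_density hρm hρpos hρq
  haveI : IsProbabilityMeasure (q.withDensity fun U => ENNReal.ofReal (ρ U)⁻¹) := by rw [hπ']; infer_instance
  have hone : ∫⁻ y, ENNReal.ofReal (ρ y)⁻¹ ∂q = ENNReal.ofReal 1 := by
    have h : π Set.univ = 1 := measure_univ
    rw [← hπ', withDensity_apply _ MeasurableSet.univ, Measure.restrict_univ] at h
    rw [h, ENNReal.ofReal_one]
  have hA' := imhAcceptMass_toReal_eq_of_forall_le (q := q) hw0' cold hmax zero_le_one hone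
  have hrate : ((ρ cold)⁻¹)⁻¹ = (∫ V, ∏ p : Plaquette d L, w (plaquetteHolonomy V p.1 p.2.1.1 p.2.1.2)
            ∂(Measure.pi fun _ : Edge d L => haarProbability G)) /
        ((∫ g, w g ∂(haarProbability G)) ^ B.card * M ^ (Finset.univ \ B).card) := by
    rw [← hA, hA', one_div]
  have hrate' : (ρ cold)⁻¹ = (((∫ V, ∏ p : Plaquette d L, w (plaquetteHolonomy V p.1 p.2.1.1 p.2.1.2)
            ∂(Measure.pi fun _ : Edge d L => haarProbability G)) /
        ((∫ g, w g ∂(haarProbability G)) ^ B.card * M ^ (Finset.univ \ B).card)))⁻¹ := by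
    rw [← hrate, inv_inv]
  have h := imh_chain_naiveErrorBar_stationary_le (q := q) hw0' hmax hf hCf hN (x₀ := cold)
  rw [hπ'] at h
  exact h


end Summit.Ventures.LatticeQCDFlow.Theory2.Autoregressive

end
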